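import Summits.QuantumFields.YangMills.Theorems.LangevinControlUVOSLegsFromFemtoAndGapDefs
import Summits.QuantumFields.YangMills.Theorems.FemtoTransferGap
import Literature.MathematicalPhysics.QuantumFieldTheory.Sweep1ShenZhuZhuProofs
import Literature.MathematicalPhysics.QuantumFieldTheory.YangMillsOSNonempty

/-!
# `UVSeamRec` — stub D0 `stub_transport` PROVED: iso-transport of the collar currency along `e : G ≃ₜ* SU(2)`

Spine route `BalabanLadder` (route-QuantumFields-BalabanLadder), rev-2 crux `UVSeamRec` (SEAM-DECISION-g14, R3′),
BC3 skeleton `Cruxes/UVSeamRec/Lines/birth.lean` (p2 g14 `UVSeamRec_birth.lean` 2a8a3943ce4d3909), stub `stub_transport`.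

For a continuous group isomorphism `e : G ≃ₜ* H` of compact groups and lattice representation data `r₂` of `H`,
the pulled-back data `pull e r₂ = r₂.comap e` (`ρ = r₂.ρ ∘ e`, tree `LatticeRep.comap`) has the SAME large-torus
quantities as `r₂`: Wilson's torus measures correspond under `U ↦ e ∘ U` (tree `map_wilsonMeasure_of_mulEquiv`,
Haar uniqueness), the periodic lift, the translations `configShift` and the plaquette observables commute with
`U ↦ e ∘ U`, hence `torusE`, `dens`, `plane`, `torusK3`, `Q2`, `Q3` agree and `LowerBounds` / `MomentBounds6`
(any unit map `a`) transfer with the same constants (`lowerBounds_pull_iff`, `momentBounds6_pull_iff`).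
`stub_transport_proved` is the registered stub's statement VERBATIM (unit of record
`uRec β = exp (FemtoTransferGap.sizeLog β 1)`); `transport_of_continuousMulEquiv` is the unit-generic form.

Everything here is proved (no `sorry`, no new axioms); nothing is asserted about `UV`, floors or ceilings.
Refs: BrockerTomDieck1985 III (4.1) (faithful reps, pull-back); Seiler LNP 159 Ch. 2 (periodic b.c.);
folklore (Haar measure is transported along continuous isomorphisms of compact groups).
Filed for the cell by the courier seat `ym-beyond-courier` (prover filing rights, D-0016) from seat P4 g16's HOME payload
`p4-g16-files/Transport.lean` (sha16 35ec4692b0c2408b); courier delta (no mathematics added, no statement changed): one-line docstrings on the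
three `@[simp]` `rfl` lemmas `cfgMap_apply`, `pull_ρ_apply`, `pull_N` (gate `lint.docstring`); the unused-elsewhere `rfl` lemma `curvature_F`
dropped on the gate's `dedup.landed` (≡ landed `ContinuumLimitOnTrajectory.Negative.curvature_F`) and `curvature_F_pull` proved from `actionDensity_pull` by `show`.
-/

set_option autoImplicit false

noncomputable section

open MeasureTheory
open Literature.MathematicalPhysics.QuantumFieldTheory Literature.MathematicalPhysics.QuantumLattice
open Summit.QuantumFields.YangMills.Cruxes.OSLegsFromFemtoAndGap.DlrCollarTransfer

namespace Summit.QuantumFields.YangMills.Cruxes.UVSeamRec.Transport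

section Generic

variable {G H : Type} [Group G] [TopologicalSpace G] [IsTopologicalGroup G] [CompactSpace G]
  [MeasurableSpace G] [BorelSpace G]
  [Group H] [TopologicalSpace H] [IsTopologicalGroup H] [CompactSpace H]
  [MeasurableSpace H] [BorelSpace H]
  (e : G ≃ₜ* H) (r₂ : LatticeRep H)

/-- The configuration map `U ↦ e ∘ U` on `ℤ⁴`-configurations. -/
def cfgMap (U : LGConfig 4 G) : LGConfig 4 H := fun y => e (U y)

omit [IsTopologicalGroup G] [CompactSpace G] [MeasurableSpace G] [BorelSpace G]
  [IsTopologicalGroup H] [CompactSpace H] [MeasurableSpace H] [BorelSpace H] in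
/-- `cfgMap` unfolds pointwise: `cfgMap e U y = e (U y)`. -/
@[simp] theorem cfgMap_apply (U : LGConfig 4 G)
    (y : Literature.MathematicalPhysics.QuantumLattice.ZdEdge 4) :
    cfgMap e U y = e (U y) := rfl

/-- **Pull-back of lattice representation data** along `e`: `ρ = r₂.ρ ∘ e` (tree `LatticeRep.comap`). -/
def pull : LatticeRep G :=
  r₂.comap e.toMulEquiv.toMonoidHom e.continuous_toFun
    (by simpa only [MulEquiv.coe_toMonoidHom] using e.toMulEquiv.injective)

omit [IsTopologicalGroup G] [CompactSpace G] [MeasurableSpace G] [BorelSpace G]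
  [IsTopologicalGroup H] [CompactSpace H] [MeasurableSpace H] [BorelSpace H] in
/-- The pulled-back representation is `r₂.ρ ∘ e`. -/
@[simp] theorem pull_ρ_apply (g : G) : (pull e r₂).ρ g = r₂.ρ (e g) := rfl

omit [IsTopologicalGroup G] [CompactSpace G] [MeasurableSpace G] [BorelSpace G]
  [IsTopologicalGroup H] [CompactSpace H] [MeasurableSpace H] [BorelSpace H] in
/-- The pull-back keeps the matrix size `N`. -/
@[simp] theorem pull_N : (pull e r₂).N = r₂.N := rfl

omit [IsTopologicalGroup G] [CompactSpace G] [MeasurableSpace G] [BorelSpace G]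
  [IsTopologicalGroup H] [CompactSpace H] [MeasurableSpace H] [BorelSpace H] in
/-- Plaquette holonomies on `ℤ⁴` are transported by `e`. -/
theorem plaquetteHolonomyZd_cfgMap (U : LGConfig 4 G)
    (x : Literature.Probability.LatticeModels.Site 4) (i j : Fin 4) :
    plaquetteHolonomyZd (cfgMap e U) x i j = e (plaquetteHolonomyZd U x i j) := by
  simp [plaquetteHolonomyZd, cfgMap, map_mul, map_inv]

omit [IsTopologicalGroup G] [CompactSpace G] [MeasurableSpace G] [BorelSpace G]
  [IsTopologicalGroup H] [CompactSpace H] [MeasurableSpace H] [BorelSpace H] in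
/-- The plaquette observables of the pulled-back representation are those of `r₂` after `U ↦ e ∘ U`. -/
theorem plaquetteObs_pull (x : Literature.Probability.LatticeModels.Site 4) (i j : Fin 4)
    (U : LGConfig 4 G) :
    plaquetteObs (pull e r₂).ρ x i j U = plaquetteObs r₂.ρ x i j (cfgMap e U) := by
  unfold plaquetteObs
  rw [plaquetteHolonomyZd_cfgMap]
  rfl

omit [IsTopologicalGroup G] [CompactSpace G] [BorelSpace G]
  [IsTopologicalGroup H] [CompactSpace H] [BorelSpace H] in
/-- Translations commute with `U ↦ e ∘ U`. -/
theorem configShift_cfgMap (v : Literature.Probability.LatticeModels.Site 4)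
    (U : LGConfig 4 G) :
    configShift v (cfgMap e U) = cfgMap e (configShift v U) := by
  funext y
  simp only [configShift_apply, cfgMap_apply]

omit [IsTopologicalGroup G] [CompactSpace G] [MeasurableSpace G] [BorelSpace G]
  [IsTopologicalGroup H] [CompactSpace H] [MeasurableSpace H] [BorelSpace H] in
/-- The Wilson action density is transported. -/
theorem actionDensity_pull (U : LGConfig 4 G) :
    actionDensity (pull e r₂).ρ U = actionDensity r₂.ρ (cfgMap e U) := by
  unfold actionDensity
  simp only [plaquetteObs_pull]

/-- The curvature observable is transported (the curvature species' observable IS the action density, definitionally —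
tree `ContinuumLimitOnTrajectory.Negative.curvature_F`; the payload's local `rfl` copy `curvature_F` was dropped by the courier on the
gate's `dedup.landed`, and this proof reads the definitional unfolding directly). -/
theorem curvature_F_pull (U : LGConfig 4 G) :
    (pull e r₂).curvature.F U = r₂.curvature.F (cfgMap e U) :=
  show actionDensity (pull e r₂).ρ U = actionDensity r₂.ρ (cfgMap e U) from actionDensity_pull e r₂ U

/-- The action density at a site (`dens`) is transported. -/
theorem dens_pull (x : Fin 4 → ℤ) (U : LGConfig 4 G) :
    dens G (pull e r₂) x U = dens H r₂ x (cfgMap e U) := by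
  unfold dens
  rw [curvature_F_pull, ← configShift_cfgMap]

omit [IsTopologicalGroup G] [CompactSpace G] [BorelSpace G]
  [IsTopologicalGroup H] [CompactSpace H] [BorelSpace H] in
/-- The single-plane field (`plane`) is transported. -/
theorem plane_pull (q : Fin 4 × Fin 4) (x : Fin 4 → ℤ) (U : LGConfig 4 G) :
    plane G (pull e r₂) q x U = plane H r₂ q x (cfgMap e U) := by
  unfold plane
  rw [plaquetteObs_pull, ← configShift_cfgMap]

/-- **Torus expectations are transported**: Wilson's measure of `(G, r₂.ρ ∘ e)` pushes forward to Wilson's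
measure of `(H, r₂.ρ)` under `U ↦ e ∘ U` (tree `map_wilsonMeasure_of_mulEquiv`), and the periodic lift
commutes with that map. -/
theorem torusE_pull (β : ℝ) (L : ℕ) (F : LGConfig 4 H → ℝ) :
    torusE G (pull e r₂) β L (fun U => F (cfgMap e U)) = torusE H r₂ β L F := by
  haveI : SecondCountableTopology H :=
    (r₂.continuous.isClosedEmbedding r₂.injective).isEmbedding.secondCountableTopology
  have he : Continuous e.toMulEquiv := e.continuous_toFun
  have hes : Continuous e.toMulEquiv.symm := e.continuous_invFun
  have hρ : ∀ g, (r₂.ρ.comp e.toMulEquiv.toMonoidHom) g = r₂.ρ (e.toMulEquiv g) := fun g => rfl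
  have hmap := map_wilsonMeasure_of_mulEquiv (d := 4) (ρ := r₂.ρ.comp e.toMulEquiv.toMonoidHom)
    (ρ' := r₂.ρ) e.toMulEquiv he hes hρ β (2 * L + 1)
  let eM : G ≃ᵐ H := e.toHomeomorph.toMeasurableEquiv
  let E : GaugeConfig 4 (2 * L + 1) G ≃ᵐ GaugeConfig 4 (2 * L + 1) H :=
    MeasurableEquiv.piCongrRight fun _ => eM
  have hE : (E : GaugeConfig 4 (2 * L + 1) G → GaugeConfig 4 (2 * L + 1) H) =
      fun U x => e.toMulEquiv (U x) := rfl
  have hpt : ∀ U : GaugeConfig 4 (2 * L + 1) G,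
      F (torusLift (2 * L + 1) (E U)) = F (cfgMap e (torusLift (2 * L + 1) U)) := fun U => rfl
  unfold torusE
  rw [← hmap, ← hE, integral_map_equiv]
  simp only [hpt]
  rfl

/-- `torusE` of the site density is transported. -/
theorem torusE_dens_pull (β : ℝ) (L : ℕ) (x : Fin 4 → ℤ) :
    torusE G (pull e r₂) β L (dens G (pull e r₂) x) = torusE H r₂ β L (dens H r₂ x) := by
  have h : dens G (pull e r₂) x = fun U => dens H r₂ x (cfgMap e U) :=
    funext fun U => dens_pull e r₂ x U
  rw [h, torusE_pull]

/-- `torusE` of a product of two site densities is transported. -/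
theorem torusE_dens₂_pull (β : ℝ) (L : ℕ) (x y : Fin 4 → ℤ) :
    torusE G (pull e r₂) β L (fun U => dens G (pull e r₂) x U * dens G (pull e r₂) y U) =
      torusE H r₂ β L (fun V => dens H r₂ x V * dens H r₂ y V) := by
  simp only [dens_pull]
  exact torusE_pull e r₂ β L (fun V => dens H r₂ x V * dens H r₂ y V)

/-- `torusE` of a product of three site densities is transported. -/
theorem torusE_dens₃_pull (β : ℝ) (L : ℕ) (x y z : Fin 4 → ℤ) :
    torusE G (pull e r₂) β L
        (fun U => dens G (pull e r₂) x U * dens G (pull e r₂) y U * dens G (pull e r₂) z U) =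
      torusE H r₂ β L (fun V => dens H r₂ x V * dens H r₂ y V * dens H r₂ z V) := by
  simp only [dens_pull]
  exact torusE_pull e r₂ β L (fun V => dens H r₂ x V * dens H r₂ y V * dens H r₂ z V)

/-- The torus third cumulant is transported. -/
theorem torusK3_pull (β : ℝ) (L : ℕ) (x y z : Fin 4 → ℤ) :
    torusK3 G (pull e r₂) β L x y z = torusK3 H r₂ β L x y z := by
  simp only [torusK3, torusE_dens_pull, torusE_dens₂_pull, torusE_dens₃_pull]

/-- The smeared truncated two-point function is transported. -/
theorem Q2_pull (β : ℝ) (L : ℕ) (s : ℝ) (f g : SchwartzMap (EuclideanSpace ℝ (Fin 4)) ℝ) :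
    Q2 G (pull e r₂) β L s f g = Q2 H r₂ β L s f g := by
  simp only [Q2, torusE_dens_pull, torusE_dens₂_pull]

/-- The smeared connected three-point function is transported. -/
theorem Q3_pull (β : ℝ) (L : ℕ) (s : ℝ) (f g h : SchwartzMap (EuclideanSpace ℝ (Fin 4)) ℝ) :
    Q3 G (pull e r₂) β L s f g h = Q3 H r₂ β L s f g h := by
  simp only [Q3, torusK3_pull]

/-- **`LowerBounds` transfers along `e`** (any unit map `a`, same constants). -/
theorem lowerBounds_pull_iff (a : ℝ → ℝ) :
    LowerBounds G (pull e r₂) a ↔ LowerBounds H r₂ a := by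
  simp only [LowerBounds, Q2_pull, Q3_pull]

/-- `torusE` of a single-plane field is transported. -/
theorem torusE_plane_pull (β : ℝ) (L : ℕ) (q : Fin 4 × Fin 4) (x : Fin 4 → ℤ) :
    torusE G (pull e r₂) β L (plane G (pull e r₂) q x) = torusE H r₂ β L (plane H r₂ q x) := by
  have h : plane G (pull e r₂) q x = fun U => plane H r₂ q x (cfgMap e U) :=
    funext fun U => plane_pull e r₂ q x U
  rw [h, torusE_pull]

/-- `torusE` of a centred product of single-plane fields is transported. -/
theorem torusE_planeProd_pull (β : ℝ) (L n : ℕ) (q : Fin n → Fin 4 × Fin 4)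
    (x : Fin n → (Fin 4 → ℤ)) (c : Fin n → ℝ) :
    torusE G (pull e r₂) β L (fun U => ∏ i, (plane G (pull e r₂) (q i) (x i) U - c i)) =
      torusE H r₂ β L (fun V => ∏ i, (plane H r₂ (q i) (x i) V - c i)) := by
  simp only [plane_pull]
  exact torusE_pull e r₂ β L (fun V => ∏ i, (plane H r₂ (q i) (x i) V - c i))

/-- **`MomentBounds6` transfers along `e`** (any unit map `a`, same constants). -/
theorem momentBounds6_pull_iff (a : ℝ → ℝ) :
    MomentBounds6 G (pull e r₂) a ↔ MomentBounds6 H r₂ a := by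
  simp only [MomentBounds6, torusE_plane_pull, torusE_planeProd_pull]

end Generic

/-- **Unit-generic transport to every `G ≃ₜ* SU(2)`**: floors ∧ plane-resolved ceilings for some lattice
representation of `SU(2)` in unit `a` ⇒ the same for some lattice representation of every compact group
continuously isomorphic to `SU(2)` (the representation `r₂ ∘ e`; `IsCompactSimpleLieGroup G` is not used). -/
theorem transport_of_continuousMulEquiv (a : ℝ → ℝ) :
    (letI : MeasurableSpace (Matrix.specialUnitaryGroup (Fin 2) ℂ) := borel _
     haveI : BorelSpace (Matrix.specialUnitaryGroup (Fin 2) ℂ) := ⟨rfl⟩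
     ∃ r₂ : LatticeRep (Matrix.specialUnitaryGroup (Fin 2) ℂ),
       LowerBounds (Matrix.specialUnitaryGroup (Fin 2) ℂ) r₂ a ∧
         MomentBounds6 (Matrix.specialUnitaryGroup (Fin 2) ℂ) r₂ a) →
    ∀ (G : Type) [Group G] [TopologicalSpace G] [IsTopologicalGroup G] [CompactSpace G],
      IsCompactSimpleLieGroup G → Nonempty (G ≃ₜ* Matrix.specialUnitaryGroup (Fin 2) ℂ) →
      letI : MeasurableSpace G := borel G; haveI : BorelSpace G := ⟨rfl⟩;
      ∃ r : LatticeRep G, LowerBounds G r a ∧ MomentBounds6 G r a := by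
  intro h G _ _ _ _ _ hne
  obtain ⟨e⟩ := hne
  letI : MeasurableSpace G := borel G
  haveI : BorelSpace G := ⟨rfl⟩
  obtain ⟨r₂, hlb, hmb⟩ := h
  exact ⟨pull e r₂, (lowerBounds_pull_iff e r₂ a).2 hlb, (momentBounds6_pull_iff e r₂ a).2 hmb⟩

/-- the unit of record (same abbreviation as the skeleton `Cruxes/UVSeamRec/Lines/birth.lean`). -/
noncomputable abbrev uRec : ℝ → ℝ :=
  fun β => Real.exp (Summit.QuantumFields.YangMills.Theorems.FemtoTransferGap.sizeLog β 1)

/-- **STUB D0 `stub_transport` of the `UVSeamRec` skeleton — PROVED** (statement verbatim; close the registered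
stub by `exact Summit.QuantumFields.YangMills.Cruxes.UVSeamRec.Transport.stub_transport_proved`). -/
theorem stub_transport_proved :
    (letI : MeasurableSpace (Matrix.specialUnitaryGroup (Fin 2) ℂ) := borel _
     haveI : BorelSpace (Matrix.specialUnitaryGroup (Fin 2) ℂ) := ⟨rfl⟩
     ∃ r₂ : LatticeRep (Matrix.specialUnitaryGroup (Fin 2) ℂ),
       LowerBounds (Matrix.specialUnitaryGroup (Fin 2) ℂ) r₂ uRec ∧ MomentBounds6 (Matrix.specialUnitaryGroup (Fin 2) ℂ) r₂ uRec) →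
    ∀ (G : Type) [Group G] [TopologicalSpace G] [IsTopologicalGroup G] [CompactSpace G],
      IsCompactSimpleLieGroup G → Nonempty (G ≃ₜ* Matrix.specialUnitaryGroup (Fin 2) ℂ) →
      letI : MeasurableSpace G := borel G; haveI : BorelSpace G := ⟨rfl⟩;
      ∃ r : LatticeRep G, LowerBounds G r uRec ∧ MomentBounds6 G r uRec :=
  transport_of_continuousMulEquiv uRec

end Summit.QuantumFields.YangMills.Cruxes.UVSeamRec.Transport
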